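import Literature.Probability.LatticeModels.DobrushinShlosmanInfiniteVolume
import Summits.Ventures.YMGap.Thresholds.StarUniquenessZd
import Summits.Ventures.YMGap.RobustBall.RobustMassGapDoor
import Summits.Ventures.YMGap.RobustBall.Defs
import HarnessLib

/-!
# Venture YMGap, track ROBUST-BALL (Y2) — crux Y2-X2-Zd, step 1: the vertex-star door on `ℤ^d`
# with locality radius `D`, DIRECTLY in infinite volume (uniqueness AND clustering of every DLR state)

HONEST FRAMING. WHAT THIS IS: a venture file (cell `pub-ymgap`, track Y2 ROBUST-BALL, seat ds-2).
A DOOR, generic in the specification: for ANY specification `γ` on the links of `ℤ^d` with `SU(N)`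
spins whose vertex-star kernels are quasilocal with `ℓ^∞` radius `D` (the star kernel at `s` reads the
boundary condition only on links based within sup-distance `D` of `s`), the file TYPES the star window
bound `StarWindowBoundZdR γ D ρ r` (an array `K(s; y → x) ≥ 0` supported on `starNbhdZdR D s`, the
Dobrushin–Shlosman window contraction (H1) of the star kernels for the link weight `r`, per-star received
sum `≤ ρ`) — the radius-`D` twin of ds-1's `DSWindowZd.StarWindowBoundZd` (Wilson kernels, radius `2`) —
and PROVES, for `ρ < 1` and the Frobenius weight:
* `hasUniqueGibbsMeasure_of_starWindowBoundZdR` — AT MOST ONE Gibbs measure, plus existence from a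
  nonemptiness hypothesis (tree `DobrushinShlosman.subsingleton_gibbsMeasures_of_window`, arbitrary index
  set, fed with the radius-`D` exhaustion `exists_starExhaustionR`);
* `abs_covariance_le_of_starWindowBoundZdR` — EXPONENTIAL CLUSTERING OF EVERY GIBBS MEASURE directly in
  infinite volume: `|cov_μ(f, g)| ≤ 4(2√N)² e^{−κ₁ ⌊dist(Δf, Δg)/(D+2)⌋} (Σ δf)(Σ δg)`,
  `κ₁ = (1−ρ)²/(2(2ρ·2d+1))` (tree `DobrushinShlosman.abs_covariance_le_of_window`, Föllmer's tilt trick on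
  an arbitrary index set — its first use in the programme; fed with the two-set profile
  `exists_starProfileR`). No torus, no thermodynamic limit.
This is the door of crux Y2-X2-Zd (the robust vertex-star door on `ℤ^d`): the member files discharge the
schema for the perturbed specifications `perturbedYM` of the gauge-invariant tier-1 `ℤ^d` ball by chart
transfer from the torus door `RobustStarDoor`. WHAT THIS IS NOT: no array is constructed and no number
is certified here; strong-coupling LATTICE bookkeeping — nothing about the continuum or the Millennium
problem.

## References
* R. L. Dobrushin, S. B. Shlosman, in *Statistical Physics and Dynamical Systems* (1985), Thm. 1;
  H. Föllmer, LNM 1362 (1988) Ch. I Thm. (2.13); H.-O. Georgii (2011) Thm. 8.7, §8.2.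
* The tree: `DobrushinShlosmanUniqueness.lean`, `DobrushinShlosmanInfiniteVolume.lean` (lit),
  `Thresholds/StarUniquenessZd.lean` (ds-1: star geometry of `ℤ^d`, followed line by line).
-/

noncomputable section

open MeasureTheory ProbabilityTheory Function Finset
open Literature.Probability.LatticeModels
open Literature.Probability.LatticeModels.DobrushinMetric (IsLipBound)
open Literature.MathematicalPhysics.QuantumLattice
open Literature.MathematicalPhysics.QuantumFieldTheory (suFrobDist suFrobDist_nonneg suFrobDist_le suEntries
  dist_suEntries_le_suFrobDist measurableSpace_specialUnitaryGroup_eq_comap setDistEdges linkSetDist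
  linkSetDist_nonneg linkSetDist_eq_zero_of_mem setDistEdges_le_linkSetDist setDistEdges_nonneg)
open Summit.Ventures.YMGap.DSWindowZd

namespace Summit.Ventures.YMGap.RobustBall

variable {d N : ℕ}

/-! ### Locality sets of sup-radius `D` around a vertex -/

/-- The **radius-`D` locality set of the vertex `s`**: all positively oriented links of `ℤ^d` whose
initial point lies within sup-distance `D` of `s`. [folklore] -/
def starNbhdZdR (D : ℕ) (s : Site d) : Finset (ZdEdge d) :=
  ((box d D).image fun z => z + s) ×ˢ (Finset.univ : Finset (Fin d))

/-- Membership in the radius-`D` locality set: every coordinate of `y.1 − s` is at most `D` in absolute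
value. [folklore] -/
theorem mem_starNbhdZdR {D : ℕ} {s : Site d} {y : ZdEdge d} :
    y ∈ starNbhdZdR D s ↔ ∀ i, (y.1 i - s i).natAbs ≤ D := by
  simp only [starNbhdZdR, Finset.mem_product, Finset.mem_univ, and_true, Finset.mem_image, mem_box]
  constructor
  · rintro ⟨z, hz, hzy⟩ i
    have h := hz i
    have : y.1 i - s i = z i := by rw [← hzy]; simp
    rw [this]; omega
  · intro h
    refine ⟨y.1 - s, fun i => ?_, sub_add_cancel _ _⟩
    have := h i
    simp only [Pi.sub_apply]; omega

/-- The vertex star lies in every locality set of radius `≥ 1`. [folklore] -/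
theorem vertexStarZd_subset_starNbhdZdR {D : ℕ} (hD : 1 ≤ D) (s : Site d) :
    vertexStarZd s ⊆ starNbhdZdR D s := fun _ hx =>
  mem_starNbhdZdR.2 fun i => (natAbs_sub_le_one_of_mem_vertexStarZd hx i).trans hD

/-- The Wilson locality set of a star (ds-1's `starNbhdZd`) lies in every locality set of radius `≥ 2`. [folklore] -/
theorem starNbhdZd_subset_starNbhdZdR {D : ℕ} (hD : 2 ≤ D) (s : Site d) :
    starNbhdZd s ⊆ starNbhdZdR D s := fun _ hy =>
  mem_starNbhdZdR.2 fun i => (natAbs_sub_le_two_of_mem_starNbhdZd hy i).trans hD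

/-- Sup-norm of a site of `ℤ^d` from coordinate bounds: `|a i| ≤ n` for all `i` gives `‖a‖ ≤ n`. [folklore] -/
theorem norm_le_of_natAbs_le {a : Site d} {n : ℕ} (h : ∀ i, (a i).natAbs ≤ n) : ‖a‖ ≤ n := by
  refine (pi_norm_le_iff_of_nonneg (Nat.cast_nonneg n)).2 fun i => ?_
  rw [Int.norm_eq_abs, ← Int.cast_abs, Int.abs_eq_natAbs]
  exact_mod_cast h i

/-! ### The hypothesis schema -/

variable (d N) in
/-- **The star window bound on `ℤ^d` with locality radius `D` and received sum `≤ ρ`** for a specification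
`γ` on the links of `ℤ^d` with `SU(N)` spins and a link weight `r`: there is a vertex-indexed array
`K(s; y → x) ≥ 0`, supported on boundary links `y ∈ starNbhdZdR D s`, such that (H1) for every centre `c`,
every link `y` outside the star `starWinZd c`, all exterior fields `ω = η` off `y`, and every bounded
measurable star-local `f` with link-Lipschitz vector `δ ≥ 0`,
`|γ_⋆ f(ω) − γ_⋆ f(η)| ≤ (Σ_{x ∈ ⋆} K(c.1; y → x) δ x) · r(ω_y, η_y)`, and (H2) the per-star received sum
`Σ_y K(s; y → x) ≤ ρ` for every `x ∈ vertexStarZd s`. The radius-`D` twin of ds-1's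
`DSWindowZd.StarWindowBoundZd` (= Wilson kernels, radius `2`). A `Prop`; nothing asserted. [folklore] -/
def StarWindowBoundZdR (γ : Specification (ZdEdge d) (SUN N)) (D : ℕ) (ρ : ℝ) (r : SUN N → SUN N → ℝ) :
    Prop :=
  ∃ K : Site d → ZdEdge d → ZdEdge d → ℝ,
    (∀ s y x, 0 ≤ K s y x) ∧ (∀ s y x, K s y x ≠ 0 → y ∈ starNbhdZdR D s) ∧
    (∀ (c y : ZdEdge d), y ∉ starWinZd c →
      ∀ (ω η : LGConfig d (SUN N)), (∀ v, v ≠ y → ω v = η v) →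
      ∀ (f : LGConfig d (SUN N) → ℝ) (δ : ZdEdge d → ℝ),
        Measurable f → (∃ B, ∀ σ, |f σ| ≤ B) → DependsOn f (starWinZd c : Set (ZdEdge d)) →
        (∀ x, 0 ≤ δ x) →
        (∀ (x : ZdEdge d) (σ τ : LGConfig d (SUN N)), (∀ v, v ≠ x → σ v = τ v) →
          |f σ - f τ| ≤ δ x * r (σ x) (τ x)) →
          |∫ σ, f σ ∂(γ (starWinZd c) ω) - ∫ σ, f σ ∂(γ (starWinZd c) η)| ≤
            (∑ x ∈ starWinZd c, K c.1 y x * δ x) * r (ω y) (η y)) ∧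
    ∀ (s : Site d) (x : ZdEdge d), x ∈ vertexStarZd s → ∑ y ∈ starNbhdZdR D s, K s y x ≤ ρ

/-! ### Exhaustion and profiles of radius `D` -/

/-- **Exhaustion for the star windows with locality radius `D`** (ds-1's `exists_starExhaustion` with the
profile `⌊(M − ‖x‖_∞)/(D+2)⌋`): for every finite `Δ` and depth `L₀` there are a finite `Λ ⊇ Δ` and a
profile `ℓ ≥ L₀` on `Δ` such that every star through a link of positive profile has its centre and its
radius-`D` locality set inside `Λ`, and `ℓ` drops by at most one along the support of any array supported
in the locality sets. [folklore] -/
theorem exists_starExhaustionR (D : ℕ) (K : Site d → ZdEdge d → ZdEdge d → ℝ)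
    (hKsupp : ∀ s y x, K s y x ≠ 0 → y ∈ starNbhdZdR D s) (Δ : Finset (ZdEdge d)) (L₀ : ℕ) :
    ∃ (Λ : Finset (ZdEdge d)) (ℓ : ZdEdge d → ℕ), Δ ⊆ Λ ∧
      (∀ x, ℓ x ≠ 0 → ∀ c, x ∈ starWinZd c → c ∈ Λ ∧ starNbhdZdR D c.1 ⊆ Λ) ∧
      (∀ c x y, x ∈ starWinZd c → K c.1 y x ≠ 0 → ℓ x ≤ ℓ y + 1) ∧ (∀ x ∈ Δ, L₀ ≤ ℓ x) := by
  classical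
  set B : ℕ := Δ.sup fun x => supNormZd x.1 with hB
  set M : ℕ := B + (D + 2) * L₀ + (D + 2) with hM
  refine ⟨(box d (M + D + 2)) ×ˢ (Finset.univ : Finset (Fin d)), fun x => (M - supNormZd x.1) / (D + 2),
    ?_, ?_, ?_, ?_⟩
  · intro x hx
    have hxB : supNormZd x.1 ≤ B := Finset.le_sup (f := fun x : ZdEdge d => supNormZd x.1) hx
    refine Finset.mem_product.2 ⟨mem_box.2 fun i => ?_, Finset.mem_univ _⟩
    have h := natAbs_le_supNormZd x.1 i
    omega
  · intro x hx c hxc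
    have hxM : supNormZd x.1 + (D + 2) ≤ M := by
      by_contra h
      exact hx (Nat.div_eq_of_lt (by omega))
    have hcx : supNormZd c.1 ≤ supNormZd x.1 + 1 := by
      refine supNormZd_le_add fun i => ?_
      have h := natAbs_sub_le_one_of_mem_vertexStarZd hxc i
      rwa [← Int.natAbs_neg, neg_sub] at h
    refine ⟨Finset.mem_product.2 ⟨mem_box.2 fun i => ?_, Finset.mem_univ _⟩, fun y hy => ?_⟩
    · have h := natAbs_le_supNormZd c.1 i
      omega
    · have hyc : supNormZd y.1 ≤ supNormZd c.1 + D := supNormZd_le_add fun i => (mem_starNbhdZdR.1 hy) i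
      refine Finset.mem_product.2 ⟨mem_box.2 fun i => ?_, Finset.mem_univ _⟩
      have h := natAbs_le_supNormZd y.1 i
      omega
  · intro c x y hxc hK
    have hy : y ∈ starNbhdZdR D c.1 := hKsupp _ _ _ hK
    have hyx : supNormZd y.1 ≤ supNormZd x.1 + (D + 1) := by
      refine supNormZd_le_add fun i => ?_
      have h1 := natAbs_sub_le_one_of_mem_vertexStarZd hxc i
      have h2 := (mem_starNbhdZdR.1 hy) i
      omega
    show (M - supNormZd x.1) / (D + 2) ≤ (M - supNormZd y.1) / (D + 2) + 1
    have h1 : M - supNormZd x.1 ≤ (M - supNormZd y.1) + (D + 2) := by omega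
    calc (M - supNormZd x.1) / (D + 2) ≤ ((M - supNormZd y.1) + (D + 2)) / (D + 2) :=
          Nat.div_le_div_right h1
      _ = (M - supNormZd y.1) / (D + 2) + 1 := Nat.add_div_right _ (by omega)
  · intro x hx
    have hxB : supNormZd x.1 ≤ B := Finset.le_sup (f := fun x : ZdEdge d => supNormZd x.1) hx
    show L₀ ≤ (M - supNormZd x.1) / (D + 2)
    rw [Nat.le_div_iff_mul_le (by omega)]
    have : L₀ * (D + 2) = (D + 2) * L₀ := Nat.mul_comm _ _
    omega

/-- **The two-set profile for covariance decay with locality radius `D ≥ 1`.** For finite `Δf, Δg` and an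
array supported in the radius-`D` locality sets there are a finite `Λ ⊇ Δf` and a profile
`ℓ x = min(⌊dist(x, Δg)/(D+2)⌋, ⌊(M − ‖x‖_∞)/(D+2)⌋)` such that: every star through a link of positive
profile has its centre and locality set inside `Λ` and avoids `Δg`; `ℓ` drops by at most one along the
support of the array; and `ℓ ≥ ⌊dist(Δf, Δg)/(D+2)⌋` on `Δf` — the hypotheses `hU`, `hℓ`, `hL` of the
tree's `DobrushinShlosman.abs_covariance_le_of_window`. [folklore] -/
theorem exists_starProfileR {D : ℕ} (hD : 1 ≤ D) (K : Site d → ZdEdge d → ZdEdge d → ℝ)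
    (hKsupp : ∀ s y x, K s y x ≠ 0 → y ∈ starNbhdZdR D s) (Δf Δg : Finset (ZdEdge d)) :
    ∃ (Λ : Finset (ZdEdge d)) (ℓ : ZdEdge d → ℕ), Δf ⊆ Λ ∧
      (∀ x, ℓ x ≠ 0 → ∀ c, x ∈ starWinZd c →
        c ∈ Λ ∧ starNbhdZdR D c.1 ⊆ Λ ∧ ∀ z ∈ starWinZd c, z ∉ Δg) ∧
      (∀ c x y, x ∈ starWinZd c → K c.1 y x ≠ 0 → ℓ x ≤ ℓ y + 1) ∧
      (∀ x ∈ Δf, ⌊setDistEdges Δf Δg / (D + 2 : ℕ)⌋₊ ≤ ℓ x) := by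
  classical
  set L₀ : ℕ := ⌊setDistEdges Δf Δg / (D + 2 : ℕ)⌋₊ with hL₀
  obtain ⟨Λ, ℓ₀, hΔΛ, hU₀, hℓ₀, hL⟩ := exists_starExhaustionR D K hKsupp Δf L₀
  have hD2 : (0 : ℝ) < (D + 2 : ℕ) := by positivity
  refine ⟨Λ, fun x => min (⌊linkSetDist Δg x / (D + 2 : ℕ)⌋₊) (ℓ₀ x), hΔΛ, ?_, ?_, ?_⟩
  · intro x hx c hxc
    have hx0 : ℓ₀ x ≠ 0 := by
      intro h; apply hx; show min _ _ = 0; rw [h, Nat.min_zero]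
    have hx1 : ⌊linkSetDist Δg x / (D + 2 : ℕ)⌋₊ ≠ 0 := by
      intro h; apply hx; show min _ _ = 0; rw [h, Nat.zero_min]
    have hdist : ((D + 2 : ℕ) : ℝ) ≤ linkSetDist Δg x := by
      by_contra h
      exact hx1 (Nat.floor_eq_zero.2 ((div_lt_one hD2).2 (not_le.mp h)))
    refine ⟨(hU₀ x hx0 c hxc).1, (hU₀ x hx0 c hxc).2, fun z hz hzg => ?_⟩
    have hzx : ‖x.1 - z.1‖ ≤ (2 : ℕ) := by
      refine norm_le_of_natAbs_le fun i => ?_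
      have h1 := natAbs_sub_le_one_of_mem_vertexStarZd hxc i
      have h2 := natAbs_sub_le_one_of_mem_vertexStarZd hz i
      simp only [Pi.sub_apply]
      omega
    have h0 : linkSetDist Δg z = 0 := linkSetDist_eq_zero_of_mem hzg
    have h3 := linkSetDist_le_add_norm Δg x z
    have hD' : (2 : ℝ) + 1 ≤ ((D + 2 : ℕ) : ℝ) := by
      have : (3 : ℕ) ≤ D + 2 := by omega
      have h := (Nat.cast_le (α := ℝ)).2 this
      push_cast at h ⊢; linarith
    push_cast at hzx hD' hdist
    linarith
  · intro c x y hxc hK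
    have hy : y ∈ starNbhdZdR D c.1 := hKsupp _ _ _ hK
    have hyx : ‖x.1 - y.1‖ ≤ ((D + 1 : ℕ) : ℝ) := by
      refine norm_le_of_natAbs_le fun i => ?_
      have h1 := natAbs_sub_le_one_of_mem_vertexStarZd hxc i
      have h2 := (mem_starNbhdZdR.1 hy) i
      simp only [Pi.sub_apply]
      omega
    have hfl : ⌊linkSetDist Δg x / (D + 2 : ℕ)⌋₊ ≤ ⌊linkSetDist Δg y / (D + 2 : ℕ)⌋₊ + 1 := by
      have h1 : linkSetDist Δg x / (D + 2 : ℕ) ≤ linkSetDist Δg y / (D + 2 : ℕ) + 1 := by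
        rw [div_add_one hD2.ne', div_le_div_iff_of_pos_right hD2]
        have h3 := linkSetDist_le_add_norm Δg x y
        have h4 : ((D + 1 : ℕ) : ℝ) ≤ ((D + 2 : ℕ) : ℝ) := by exact_mod_cast Nat.le_succ _
        linarith
      calc ⌊linkSetDist Δg x / (D + 2 : ℕ)⌋₊ ≤ ⌊linkSetDist Δg y / (D + 2 : ℕ) + 1⌋₊ := Nat.floor_mono h1
        _ = ⌊linkSetDist Δg y / (D + 2 : ℕ)⌋₊ + 1 :=
            Nat.floor_add_one (div_nonneg (linkSetDist_nonneg _ _) hD2.le)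
    have h2 := hℓ₀ c x y hxc hK
    calc min (⌊linkSetDist Δg x / (D + 2 : ℕ)⌋₊) (ℓ₀ x)
        ≤ min (⌊linkSetDist Δg y / (D + 2 : ℕ)⌋₊ + 1) (ℓ₀ y + 1) := min_le_min hfl h2
      _ = min (⌊linkSetDist Δg y / (D + 2 : ℕ)⌋₊) (ℓ₀ y) + 1 := min_add_add_right _ _ _
  · intro x hx
    refine le_min ?_ (hL x hx)
    exact Nat.floor_mono (div_le_div_of_nonneg_right (setDistEdges_le_linkSetDist hx) hD2.le)

/-! ### The door: uniqueness and clustering of every Gibbs measure -/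

/-- **UNIQUENESS through the radius-`D` star door.** For a specification `γ` on the links of `ℤ^d` with
`SU(N)` spins (`IsSpecification`) whose star kernels are quasilocal with radius `D ≥ 1` (`hloc`) and which
has at least one Gibbs measure, the star window bound with received sum `ρ < 1` for the Frobenius weight
gives `HasUniqueGibbsMeasure γ` (tree `DobrushinShlosman.subsingleton_gibbsMeasures_of_window`, arbitrary
index set, `≤ 2d` stars through a link, the exhaustion `exists_starExhaustionR`, and the Frobenius-coordinate
closing step `suEntries`). [folklore] -/
theorem hasUniqueGibbsMeasure_of_starWindowBoundZdR {γ : Specification (ZdEdge d) (SUN N)}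
    (hγ : IsSpecification γ) (hne : (gibbsMeasures γ).Nonempty) {D : ℕ} (hD : 1 ≤ D)
    (hloc : ∀ (c : ZdEdge d) (ζ ζ' : LGConfig d (SUN N)), (∀ v ∈ starNbhdZdR D c.1, ζ v = ζ' v) →
      ∀ (f : LGConfig d (SUN N) → ℝ), Measurable f → (∃ B, ∀ σ, |f σ| ≤ B) →
        DependsOn f (starWinZd c : Set (ZdEdge d)) →
        ∫ σ, f σ ∂(γ (starWinZd c) ζ) = ∫ σ, f σ ∂(γ (starWinZd c) ζ'))
    {ρ : ℝ} (hρ0 : 0 ≤ ρ) (hρ1 : ρ < 1) (h : StarWindowBoundZdR d N γ D ρ suFrobDist) :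
    HasUniqueGibbsMeasure γ := by
  classical
  haveI : SecondCountableTopology (Matrix (Fin N) (Fin N) ℂ) :=
    inferInstanceAs (SecondCountableTopology (Fin N → Fin N → ℂ))
  haveI : SecondCountableTopology (SUN N) := Topology.IsEmbedding.subtypeVal.secondCountableTopology
  obtain ⟨K, hK0, hKsupp, hcontract, hsum⟩ := h
  have hR₀ : (0 : ℝ) ≤ 2 * Real.sqrt N := by positivity
  have hA : ∀ a b : SUN N, dist (suEntries a) (suEntries b) ≤ 1 * suFrobDist a b := fun a b => by
    rw [one_mul]; exact dist_suEntries_le_suFrobDist a b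
  refine ⟨?_, hne⟩
  exact DobrushinShlosman.subsingleton_gibbsMeasures_of_window hγ suFrobDist_nonneg suFrobDist_le hR₀
    (win := starWinZd) (nbhd := fun c => starNbhdZdR D c.1) (K := fun c => K c.1) (fun c y x => hK0 _ _ _)
    self_mem_starWinZd (fun c => vertexStarZd_subset_starNbhdZdR hD c.1) (fun c y x => hKsupp _ _ _)
    hcontract hloc hρ0 hρ1 (fun c x hx => hsum c.1 x hx) (Nstar := 2 * d)
    card_filter_mem_starWinZd_le (exists_starExhaustionR D K hKsupp) suEntries
    measurableSpace_specialUnitaryGroup_eq_comap zero_le_one hA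

/-- The decay rate of the star door with received sum `ρ` in dimension `d`:
`κ₁ = (1 − ρ)²/(2(2ρ·2d + 1))` (`2d` = stars through a link). [folklore] -/
def starRate (d : ℕ) (ρ : ℝ) : ℝ := (1 - ρ) ^ 2 / (2 * (2 * ρ * (2 * d : ℕ) + 1))

/-- The decay rate is positive for `0 ≤ ρ < 1`. [folklore] -/
theorem starRate_pos {ρ : ℝ} (hρ0 : 0 ≤ ρ) (hρ1 : ρ < 1) : 0 < starRate d ρ := by
  unfold starRate
  have h1 : 0 < (1 - ρ) ^ 2 := by nlinarith
  positivity

/-- **EXPONENTIAL CLUSTERING OF EVERY GIBBS MEASURE through the radius-`D` star door, directly in infinite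
volume.** Under the hypotheses of `hasUniqueGibbsMeasure_of_starWindowBoundZdR` (without nonemptiness),
every Gibbs measure `μ` of `γ` satisfies, for bounded measurable `f, g` depending only on the finite link
sets `Δf, Δg` with Frobenius-Lipschitz vectors `δf, δg`:
`|cov_μ(f, g)| ≤ 4(2√N)² exp(−κ₁ ⌊dist(Δf, Δg)/(D+2)⌋) (Σ δf)(Σ δg)`, `κ₁ = starRate d ρ`, `dist` the
sup-distance of base points (`setDistEdges`) (tree `DobrushinShlosman.abs_covariance_le_of_window`, the
two-set profile `exists_starProfileR`). [folklore] -/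
theorem abs_covariance_le_of_starWindowBoundZdR {γ : Specification (ZdEdge d) (SUN N)}
    (hγ : IsSpecification γ) {D : ℕ} (hD : 1 ≤ D)
    (hloc : ∀ (c : ZdEdge d) (ζ ζ' : LGConfig d (SUN N)), (∀ v ∈ starNbhdZdR D c.1, ζ v = ζ' v) →
      ∀ (f : LGConfig d (SUN N) → ℝ), Measurable f → (∃ B, ∀ σ, |f σ| ≤ B) →
        DependsOn f (starWinZd c : Set (ZdEdge d)) →
        ∫ σ, f σ ∂(γ (starWinZd c) ζ) = ∫ σ, f σ ∂(γ (starWinZd c) ζ'))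
    {ρ : ℝ} (hρ0 : 0 ≤ ρ) (hρ1 : ρ < 1) (h : StarWindowBoundZdR d N γ D ρ suFrobDist)
    {μ : Measure (LGConfig d (SUN N))} (hμ : IsGibbsMeasure γ μ)
    {f g : LGConfig d (SUN N) → ℝ} (hfm : Measurable f) (hgm : Measurable g) {Bf Bg : ℝ}
    (hBf : ∀ σ, |f σ| ≤ Bf) (hBg : ∀ σ, |g σ| ≤ Bg) {Δf Δg : Finset (ZdEdge d)}
    (hfdep : DependsOn f (Δf : Set (ZdEdge d))) (hgdep : DependsOn g (Δg : Set (ZdEdge d)))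
    {δf δg : ZdEdge d → ℝ} (hδf : IsLipBound suFrobDist f δf) (hδg : IsLipBound suFrobDist g δg) :
    |cov[f, g; μ]| ≤ 4 * (2 * Real.sqrt N) ^ 2 *
      Real.exp (-(starRate d ρ * ⌊setDistEdges Δf Δg / (D + 2 : ℕ)⌋₊)) *
      (∑ x ∈ Δf, δf x) * ∑ y ∈ Δg, δg y := by
  classical
  obtain ⟨K, hK0, hKsupp, hcontract, hsum⟩ := h
  have hR₀ : (0 : ℝ) ≤ 2 * Real.sqrt N := by positivity
  obtain ⟨Λ, ℓ, hΔΛ, hU, hℓ, hL⟩ := exists_starProfileR hD K hKsupp Δf Δg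
  exact DobrushinShlosman.abs_covariance_le_of_window hγ suFrobDist_nonneg suFrobDist_le hR₀
    (win := starWinZd) (nbhd := fun c => starNbhdZdR D c.1) (K := fun c => K c.1) (fun c y x => hK0 _ _ _)
    self_mem_starWinZd (fun c => vertexStarZd_subset_starNbhdZdR hD c.1) (fun c y x => hKsupp _ _ _)
    hcontract hloc hρ0 hρ1 (fun c x hx => hsum c.1 x hx) (Nstar := 2 * d)
    card_filter_mem_starWinZd_le hμ hfm hgm hBf hBg hfdep hgdep hδf hδg Λ hΔΛ ℓ _ hU hℓ hL

end Summit.Ventures.YMGap.RobustBall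

end
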